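import Summits.ResolutionOfSingularities.ResolutionOfSingularities.Theorems.PurelyInseparableDim4JointForestWaitingThreefolds
import HarnessLib

/-!
# Purely inseparable four-folds: DEPTH THREE UNDER A WAITING KID — `z^p + x₁^p x₂^{2p} x₃`: host, waiting kid, then a CHILD of the
# waiting kid, every `p` (brick S3 (c) «joint point∘coordinate chains», part 45 = instance inst₁₄; cell `res-dim4-pi`)

[OURS · counted 0] (D-0157 DOOR 2; desk WORD #66 (4)(c), #74 (g), #99 (d); frame `PIDim4.TerminationImpliesOrderReduction`, S3 (c)
v3-lite; host item stmt-ResolutionOfSingularities-16155, helper). Nothing here proves resolution of singularities in dimension ≥ 4 /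
characteristic `p` — NOT here, not anywhere in this programme.

`F = x₁^p x₂^{2p} x₃` over `K = K̄` of characteristic `p` (variables `x₁…x₄` = `X 0…X 3`). Order-`p` locus: the 3-folds `V(z, x₁)` and
`V(z, x₂)` (`roots_depthThree`), meeting in a surface. HOST `(0, {x₁})`, WAITING ENTRY `(x₁, 0, {x₂})`. The host's chart reads `y₂^{2p} y₃`
(`chartTransform_S_depthThree`): its equimultiple pairs `{y₂ = 0}` ARE the waiting kid (`cases_S_depthThree`), state `y₂^{2p} y₃`. Blowing
up the waiting kid `V(z′, y₂)` reads `y₂^p y₃` — EVERY pair of its exceptional hyperplane is equimultiple: a CHILD `(y₂, 0, {y₂})` of the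
waiting kid (v2 plan entry, `T ⊆ S″`), state `y₂^p y₃` (part 40's `H`); its blow-up reads `y₃`, DEAD (part 40). So the plan BELOW the
waiting kid is NON-EMPTY — the first certificate exercising part 38's hereditary `hplan` with an actual entry under a waiting kid:

* §1 computations; §2 **`exists_isMarkedResolution_inst₁₄`** — `(𝔸⁵_K, (z^p + x₁^p x₂^{2p} x₃)·𝒪, [], p)` admits a marked resolution
  (BGMW Def. 3.1.3): root → host blow-up → waiting-kid blow-up → child blow-up; by part 38 with `Pl₀ = L₀ = ∅`, `Wt = {(x₁, 0, {x₂})}`,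
  `plan s _ = {(x₂, 0, {x₂})}` iff `s.F = y₂^{2p} y₃`. UNCONDITIONAL, every `p`.

AI-produced formalisation, weaker than expert review. bears_on: LADDER-RESOLUTION:D157-DOOR2 (res-dim4-pi · S3 (c) joint v3-lite ·
depth three under a waiting kid).
-/

set_option linter.dupNamespace false -- D-0017: single-problem summit path `Summit.<S>.<S>.…` by design

noncomputable section

open MvPolynomial Finset CategoryTheory AlgebraicGeometry Opposite TopologicalSpace

namespace Summit.ResolutionOfSingularities.ResolutionOfSingularities.Theorems.PIDim4

open Literature.AlgebraicGeometry.Resolution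
open Literature.AlgebraicGeometry.Resolution.Hauser2010
open Literature.AlgebraicGeometry.Resolution.AffinePointBlowup (P A γ coord Wtop ξ)

namespace Equimultiple

section Instance₁₄

variable {K : Type} [Field K] {p : ℕ} [hp : Fact p.Prime] [CharP K p]

/-! ## §1 Computations -/

omit hp [CharP K p] in
/-- `F = x₁^p x₂^{2p} x₃` is one monomial. [folklore] -/
theorem depthThree_eq_monomial :
    (X 0 ^ p * X 1 ^ (2 * p) * X 2 : MvPolynomial (Fin 4) K) =
      monomial (Finsupp.single 0 p + Finsupp.single 1 (2 * p) + Finsupp.single 2 1) 1 := by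
  rw [X_pow_eq_monomial, X_pow_eq_monomial, X, monomial_mul, monomial_mul, mul_one, mul_one]

omit hp [CharP K p] in
/-- The support of `F` is its exponent. [folklore] -/
theorem mem_support_depthThree {d : Fin 4 →₀ ℕ} (hd : d ∈ (X 0 ^ p * X 1 ^ (2 * p) * X 2 : MvPolynomial (Fin 4) K).support) :
    d = Finsupp.single 0 p + Finsupp.single 1 (2 * p) + Finsupp.single 2 1 := by
  rw [depthThree_eq_monomial] at hd
  exact Finset.mem_singleton.mp (Finset.mem_of_subset support_monomial_subset hd)

omit [CharP K p] in
/-- `F` is clean (exponent `1` of `x₃`). [cite: HauserPerlega2019PRIMS, §2 (cleaning)] -/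
theorem isClean_depthThree :
    Literature.Barriers.ResolutionOfSingularities.HauserPerlega.IsClean p (X 0 ^ p * X 1 ^ (2 * p) * X 2 : MvPolynomial (Fin 4) K) := by
  intro d hd hpth
  rw [mem_support_depthThree hd] at hpth
  have h := hpth 2 (by simp)
  simp only [Finsupp.coe_add, Pi.add_apply, Finsupp.single_eq_same] at h
  rw [Finsupp.single_eq_of_ne (by decide), Finsupp.single_eq_of_ne (by decide), zero_add, zero_add] at h
  exact hp.out.one_lt.ne' (Nat.dvd_one.mp h)

omit hp [CharP K p] in
/-- `F ≠ 0`. [folklore] -/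
theorem depthThree_ne_zero : (X 0 ^ p * X 1 ^ (2 * p) * X 2 : MvPolynomial (Fin 4) K) ≠ 0 := by
  rw [depthThree_eq_monomial]
  exact monomial_eq_zero.not.mpr one_ne_zero

omit hp [CharP K p] in
/-- **`V(z, x₁)` is Hironaka-permissible for `z^p + F`** (the host). [cite: HauserPerlega2019PRIMS, §2 (condition (1))] -/
theorem isPermissibleCentre_S_depthThree :
    IsPermissibleCentre p ({0} : Finset (Fin 4)) (X 0 ^ p * X 1 ^ (2 * p) * X 2 : MvPolynomial (Fin 4) K) := by
  refine ⟨⟨0, Finset.mem_singleton_self _⟩, Finset.le_inf fun d hd => ?_⟩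
  rw [mem_support_depthThree hd]
  simp [CentreBlowup.degIn_singleton]

omit hp [CharP K p] in
/-- **`V(z, x₂)` is Hironaka-permissible for `z^p + F`** (the waiting member). [cite: HauserPerlega2019PRIMS, §2 (condition (1))] -/
theorem isPermissibleCentre_T_depthThree :
    IsPermissibleCentre p ({1} : Finset (Fin 4)) (X 0 ^ p * X 1 ^ (2 * p) * X 2 : MvPolynomial (Fin 4) K) := by
  refine ⟨⟨1, Finset.mem_singleton_self _⟩, Finset.le_inf fun d hd => ?_⟩
  rw [mem_support_depthThree hd]
  simp [CentreBlowup.degIn_singleton]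
  exact_mod_cast (show p ≤ 2 * p by omega)

omit [CharP K p] in
/-- **The root parameters**: order `p` at `(a, b)` forces `b₁ = 0 ∨ b₂ = 0` (`∂F/∂x₃ = x₁^p x₂^{2p}`). [cite: Hauser2010, §F (equiconstant points)] -/
theorem roots_depthThree (b : Fin 4 → K)
    (H : ∀ d : Fin 4 →₀ ℕ, d ≠ 0 → d.degree < p →
      coeff d (PointBlowup.translate b (X 0 ^ p * X 1 ^ (2 * p) * X 2 : MvPolynomial (Fin 4) K)) = 0) :
    b 0 = 0 ∨ b 1 = 0 := by
  have hp0 : p ≠ 0 := hp.out.ne_zero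
  have h2 := eval_pderiv_eq_zero_of_forall_coeff b _ H 2
  simp [(pderiv (2 : Fin 4)).leibniz_pow, hp0] at h2
  exact h2

omit hp [CharP K p] in
/-- **The `x₁`-chart of the blow-up of the host reads `y₂^{2p} y₃`.** [cite: HauserPerlega2019PRIMS, §2 (the x₁-chart)] -/
theorem chartTransform_S_depthThree :
    CentreBlowup.chartTransform p ({0} : Finset (Fin 4)) 0 (X 0 ^ p * X 1 ^ (2 * p) * X 2 : MvPolynomial (Fin 4) K) =
      X 1 ^ (2 * p) * X 2 := by
  rw [depthThree_eq_monomial, CentreBlowup.chartTransform_monomial]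
  simp only [CentreBlowup.chartExponent, CentreBlowup.degIn_singleton]
  have e1 : (Finsupp.single 0 p + Finsupp.single 1 (2 * p) + Finsupp.single 2 1 : Fin 4 →₀ ℕ).update 0
      ((Finsupp.single 0 p + Finsupp.single 1 (2 * p) + Finsupp.single 2 1 : Fin 4 →₀ ℕ) 0 - p) =
        Finsupp.single 1 (2 * p) + Finsupp.single 2 1 := by
    ext i; fin_cases i <;> simp [Finsupp.update_apply]
  rw [e1, ← X_pow_mul_X_eq_monomial]

omit [CharP K p] in
/-- `y₂^{2p} y₃` is clean. [cite: HauserPerlega2019PRIMS, §2 (cleaning)] -/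
theorem isClean_H_depthThree :
    Literature.Barriers.ResolutionOfSingularities.HauserPerlega.IsClean p (X 1 ^ (2 * p) * X 2 : MvPolynomial (Fin 4) K) := by
  intro d hd hpth
  rw [X_pow_mul_X_eq_monomial] at hd
  have hd' := Finset.mem_singleton.mp (Finset.mem_of_subset support_monomial_subset hd)
  rw [hd'] at hpth
  have h := hpth 2 (by simp)
  simp only [Finsupp.coe_add, Pi.add_apply, Finsupp.single_eq_same] at h
  rw [Finsupp.single_eq_of_ne (by decide), zero_add] at h
  exact hp.out.one_lt.ne' (Nat.dvd_one.mp h)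

omit [CharP K p] in
/-- **The equimultiple pairs of the host's chart lie on the waiting kid**: `b₂ = 0` (linear coefficient `b₂^{2p}` of `y₃`).
[cite: Hauser2010, §F (equiconstant points)] -/
theorem cases_S_depthThree [DecidableEq K] {b : Fin 4 → K} (s : State K) (hs : s.F = X 0 ^ p * X 1 ^ (2 * p) * X 2)
    (h : CentreBlowup.IsEquimultiplePoint p ({0} : Finset (Fin 4)) 0 b s) : b 1 = 0 := by
  have hp0 : p ≠ 0 := hp.out.ne_zero
  unfold CentreBlowup.IsEquimultiplePoint CentreBlowup.pointTransform at h
  rw [hs, chartTransform_S_depthThree] at h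
  have h2 := eval_pderiv_eq_zero_of_forall_coeff b _ h 2
  simp [(pderiv (2 : Fin 4)).leibniz_pow, hp0] at h2
  exact h2

omit [CharP K p] in
/-- **The waiting kid's state**: `(step p {x₁} x₁ 0 (F, 0, ∅)).F = y₂^{2p} y₃`. [cite: Hauser2010, §§F–G] -/
theorem step_S_depthThree [DecidableEq K] :
    (CentreBlowup.step p ({0} : Finset (Fin 4)) 0 (0 : Fin 4 → K) (⟨X 0 ^ p * X 1 ^ (2 * p) * X 2, 0, ∅⟩ : State K)).F =
      X 1 ^ (2 * p) * X 2 := by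
  show deletePthPowers p (PointBlowup.translate (0 : Fin 4 → K)
    (CentreBlowup.chartTransform p ({0} : Finset (Fin 4)) 0 (X 0 ^ p * X 1 ^ (2 * p) * X 2 : MvPolynomial (Fin 4) K))) = _
  rw [chartTransform_S_depthThree, PointBlowup.translate_zero]
  exact Literature.Barriers.ResolutionOfSingularities.HauserPerlega.deletePthPowers_eq_self isClean_H_depthThree

omit hp [CharP K p] in
/-- **The `y₂`-chart of the blow-up of the waiting kid `V(z′, y₂)` applied to `y₂^{2p} y₃` reads `y₂^p y₃`.**
[cite: HauserPerlega2019PRIMS, §2 (the x₁-chart)] -/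
theorem chartTransform_T_depthThree :
    CentreBlowup.chartTransform p ({1} : Finset (Fin 4)) 1 (X 1 ^ (2 * p) * X 2 : MvPolynomial (Fin 4) K) = X 1 ^ p * X 2 := by
  rw [X_pow_mul_X_eq_monomial, CentreBlowup.chartTransform_monomial]
  simp only [CentreBlowup.chartExponent, CentreBlowup.degIn_singleton]
  have e1 : (Finsupp.single 1 (2 * p) + Finsupp.single 2 1 : Fin 4 →₀ ℕ).update 1
      ((Finsupp.single 1 (2 * p) + Finsupp.single 2 1 : Fin 4 →₀ ℕ) 1 - p) = Finsupp.single 1 p + Finsupp.single 2 1 := by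
    ext i; fin_cases i <;> simp [Finsupp.update_apply]; omega
  rw [e1, ← X_pow_mul_X_eq_monomial]

omit hp [CharP K p] in
/-- **EVERY pair of the waiting kid's exceptional hyperplane with `b = 0` is equimultiple for `y₂^{2p} y₃`** — the child `(y₂, 0, {y₂})`
is an admissible plan entry (its pairs all agree with it on `{y₂}`). [cite: Hauser2010, §F (equiconstant points)] -/
theorem isEquimultiplePoint_T_zero_depthThree [DecidableEq K] (s : State K) (hs : s.F = X 1 ^ (2 * p) * X 2) :
    CentreBlowup.IsEquimultiplePoint p ({1} : Finset (Fin 4)) 1 (0 : Fin 4 → K) s := by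
  unfold CentreBlowup.IsEquimultiplePoint CentreBlowup.pointTransform
  rw [hs, chartTransform_T_depthThree, PointBlowup.translate_zero]
  intro d _ hdeg
  rw [X_pow_mul_X_eq_monomial, coeff_monomial, if_neg]
  intro h
  rw [← h, map_add, Finsupp.degree_single, Finsupp.degree_single] at hdeg
  omega

omit [CharP K p] in
/-- **The child's state**: `(step p {y₂} y₂ 0 s₁).F = y₂^p y₃` when `s₁.F = y₂^{2p} y₃`. [cite: Hauser2010, §§F–G] -/
theorem step_T_depthThree [DecidableEq K] (s : State K) (hs : s.F = X 1 ^ (2 * p) * X 2) :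
    (CentreBlowup.step p ({1} : Finset (Fin 4)) 1 (0 : Fin 4 → K) s).F = X 1 ^ p * X 2 := by
  show deletePthPowers p (PointBlowup.translate (0 : Fin 4 → K) (CentreBlowup.chartTransform p ({1} : Finset (Fin 4)) 1 s.F)) = _
  rw [hs, chartTransform_T_depthThree, PointBlowup.translate_zero]
  exact Literature.Barriers.ResolutionOfSingularities.HauserPerlega.deletePthPowers_eq_self isClean_H_threefolds

omit hp [CharP K p] in
/-- **`V(z, y₂)` is permissible for the child's state `y₂^p y₃`.** [cite: HauserPerlega2019PRIMS, §2 (condition (1))] -/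
theorem isPermissibleCentre_child_depthThree :
    IsPermissibleCentre p ({1} : Finset (Fin 4)) (X 1 ^ p * X 2 : MvPolynomial (Fin 4) K) := by
  refine ⟨⟨1, Finset.mem_singleton_self _⟩, Finset.le_inf fun d hd => ?_⟩
  rw [X_pow_mul_X_eq_monomial] at hd
  rw [Finset.mem_singleton.mp (Finset.mem_of_subset support_monomial_subset hd)]
  simp [CentreBlowup.degIn_singleton]

omit [CharP K p] in
/-- The child's state differs from the waiting kid's state (so the plan is empty below the child). [folklore] -/
theorem child_ne_kid_depthThree : (X 1 ^ p * X 2 : MvPolynomial (Fin 4) K) ≠ X 1 ^ (2 * p) * X 2 := by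
  intro h
  have hc := congrArg (coeff (Finsupp.single (1 : Fin 4) p + Finsupp.single 2 1)) h
  have hp0 : p ≠ 0 := hp.out.ne_zero
  have hne : (Finsupp.single (1 : Fin 4) p + Finsupp.single 2 1) ≠ Finsupp.single 1 (2 * p) + Finsupp.single 2 1 := fun h' => by
    have := DFunLike.congr_fun h' 1; simp at this; omega
  rw [X_pow_mul_X_eq_monomial, X_pow_mul_X_eq_monomial, coeff_monomial, if_pos rfl, coeff_monomial, if_neg hne.symm] at hc
  exact one_ne_zero hc

/-! ## §2 The certificate -/

/-- **DEPTH THREE UNDER A WAITING KID, CERTIFIED** (every `p`): `(𝔸⁵_K, (z^p + x₁^p x₂^{2p} x₃)·𝒪, [], p)` admits a marked resolution —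
host `V(z, x₁)`; the waiting kid `V(z′, y₂)` (state `y₂^{2p} y₃`); its child `V(z″, y₂)` (state `y₂^p y₃`); then nothing.
[cite: BierstoneGrigorievMilmanWlodarczyk2011, Def. 3.1.3] [cite: HauserPerlega2019PRIMS, §2 (permissible centres P = (z, x_i : i ∈ Γ))]
[cite: Hauser2010, §F (equiconstant points)] -/
theorem exists_isMarkedResolution_inst₁₄ [IsAlgClosed K] [DecidableEq K] :
    ∃ (X' : Scheme.{0}) (ρ : X' ⟶ P 4 K) (M' : MarkedIdeal X'),
      IsMarkedResolution (⟨hypSheaf p (X 0 ^ p * X 1 ^ (2 * p) * X 2 : MvPolynomial (Fin 4) K), [], p⟩ : MarkedIdeal (P 4 K)) ρ M' := by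
  classical
  set F : MvPolynomial (Fin 4) K := X 0 ^ p * X 1 ^ (2 * p) * X 2 with hFdef
  set s₀ : State K := ⟨F, 0, ∅⟩ with hs₀def
  have hs₀ : s₀ = ⟨deletePthPowers p (PointBlowup.translate (0 : Fin 4 → K) F), 0, ∅⟩ := by
    rw [PointBlowup.translate_zero, Literature.Barriers.ResolutionOfSingularities.HauserPerlega.deletePthPowers_eq_self isClean_depthThree]
  -- the waiting entry, the waiting kid's state, the child entry, the child's state
  set wt₀ : Fin 4 × (Fin 4 → K) × Finset (Fin 4) := ((0 : Fin 4), (0 : Fin 4 → K), ({1} : Finset (Fin 4))) with hwt₀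
  set e₀ : Fin 4 × (Fin 4 → K) × Finset (Fin 4) := ((1 : Fin 4), (0 : Fin 4 → K), ({1} : Finset (Fin 4))) with he₀
  set s₁ : State K := CentreBlowup.step p ({0} : Finset (Fin 4)) 0 (0 : Fin 4 → K) s₀ with hs₁
  have hs₁F : s₁.F = X 1 ^ (2 * p) * X 2 := by rw [hs₁, hs₀def, hFdef]; exact step_S_depthThree
  set s₂ : State K := CentreBlowup.step p ({1} : Finset (Fin 4)) 1 (0 : Fin 4 → K) s₁ with hs₂
  have hs₂F : s₂.F = X 1 ^ p * X 2 := step_T_depthThree s₁ hs₁F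
  -- the rules below the host: one child under the waiting kid, nothing else
  let plan : State K → Finset (Fin 4) → Finset (Fin 4 × (Fin 4 → K) × Finset (Fin 4)) := fun s _ =>
    if s.F = X 1 ^ (2 * p) * X 2 then {e₀} else ∅
  let leaves : State K → Finset (Fin 4) → Finset (Fin 4 × (Fin 4 → K)) := fun _ _ => ∅
  have hplan₁ : plan s₁ ({1} : Finset (Fin 4)) = {e₀} := if_pos hs₁F
  have hplan₂ : ∀ T, plan s₂ T = ∅ := fun T => if_neg (by rw [hs₂F]; exact child_ne_kid_depthThree)
  have hreach : ∀ q : State K × Finset (Fin 4),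
      Relation.ReflTransGen (fun q q' : State K × Finset (Fin 4) =>
        ∃ e ∈ plan q.1 q.2, q' = (CentreBlowup.step p q.2 e.1 e.2.1 q.1, e.2.2)) (s₁, ({1} : Finset (Fin 4))) q →
      q = (s₁, ({1} : Finset (Fin 4))) ∨ q = (s₂, ({1} : Finset (Fin 4))) := by
    intro q hq
    induction hq with
    | refl => exact Or.inl rfl
    | tail _ hR ih =>
      obtain ⟨e, he, rfl⟩ := hR
      rcases ih with h | h <;> rw [h] at he ⊢
      · rw [hplan₁, Finset.mem_singleton] at he
        subst he
        exact Or.inr rfl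
      · rw [hplan₂ ({1} : Finset (Fin 4))] at he
        exact absurd he (Finset.notMem_empty e)
  have hacc₂ : Acc (fun q' q : State K × Finset (Fin 4) =>
      ∃ e ∈ plan q.1 q.2, q' = (CentreBlowup.step p q.2 e.1 e.2.1 q.1, e.2.2)) (s₂, ({1} : Finset (Fin 4))) :=
    Acc.intro _ fun q' ⟨e, he, _⟩ => by rw [hplan₂ ({1} : Finset (Fin 4))] at he; exact absurd he (Finset.notMem_empty e)
  have hacc₁ : Acc (fun q' q : State K × Finset (Fin 4) =>
      ∃ e ∈ plan q.1 q.2, q' = (CentreBlowup.step p q.2 e.1 e.2.1 q.1, e.2.2)) (s₁, ({1} : Finset (Fin 4))) :=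
    Acc.intro _ fun q' ⟨e, he, hq'⟩ => by
      rw [hplan₁, Finset.mem_singleton] at he
      subst he; rw [hq']; exact hacc₂
  refine exists_isMarkedResolution_joint_forest_root_waiting (p := p) F depthThree_ne_zero isClean_depthThree plan leaves 0
    ({0} : Finset (Fin 4)) s₀ hs₀ isPermissibleCentre_S_depthThree ∅ {wt₀} ∅
    (fun e he => absurd he (Finset.notMem_empty e)) (fun e he => absurd he (Finset.notMem_empty e))
    (fun wt hwt => ?_) (fun wt hwt wt' hwt' hne => ?_) (fun e he => absurd he (Finset.notMem_empty e))
    (fun l hl => absurd hl (Finset.notMem_empty l)) (fun j' b' hj' hb' _ heq => ?_) (fun q hq => ?_)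
    (fun e he => absurd he (Finset.notMem_empty e)) (fun wt hwt => ?_) (fun b' H => ?_)
  · -- the waiting entry is admissible
    rw [Finset.mem_singleton] at hwt
    subst hwt
    refine ⟨by simp [hwt₀], fun i _ => rfl,
      by show (({0} : Finset (Fin 4)).erase 0) ⊆ ({1} : Finset (Fin 4)); decide,
      by show (0 : Fin 4) ∉ ({1} : Finset (Fin 4)); decide, ?_⟩
    change IsPermissibleCentre p ({1} : Finset (Fin 4)) (PointBlowup.translate (0 : Fin 4 → K) F)
    rw [PointBlowup.translate_zero, hFdef]
    exact isPermissibleCentre_T_depthThree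
  · rw [Finset.mem_singleton] at hwt hwt'
    exact absurd (hwt.trans hwt'.symm) hne
  · -- three-way cover over the host: every pair lies on the waiting kid
    have hj0 : j' = 0 := Finset.mem_singleton.mp hj'
    subst hj0
    have hb1 : b' 1 = 0 := cases_S_depthThree s₀ rfl heq
    refine Or.inr (Or.inl ⟨wt₀, Finset.mem_singleton_self _, rfl, fun i hi => ?_⟩)
    change i ∈ ({1} : Finset (Fin 4)) at hi
    rw [Finset.mem_singleton] at hi
    subst hi
    rw [hb1]; rfl
  · -- below the waiting kid: the child, then nothing
    rcases hq with ⟨e, he, -⟩ | ⟨wt, hwt, hq⟩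
    · exact absurd he (Finset.notMem_empty e)
    rw [Finset.mem_singleton] at hwt
    subst hwt
    rcases hreach q hq with rfl | rfl
    · -- at the waiting kid: one admissible child covering every pair
      rw [show plan (s₁, ({1} : Finset (Fin 4))).1 (s₁, ({1} : Finset (Fin 4))).2 = {e₀} from hplan₁]
      refine ⟨fun e he => ?_, fun e he e' he' hne' => ?_, fun l hl => absurd hl (Finset.notMem_empty l),
        fun j'' b'' hj'' hb'' _ _ => ?_⟩
      · rw [Finset.mem_singleton] at he
        subst he
        refine ⟨Finset.mem_singleton_self _, rfl, Finset.Subset.refl _, isEquimultiplePoint_T_zero_depthThree s₁ hs₁F, ?_⟩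
        change IsPermissibleCentre p ({1} : Finset (Fin 4)) s₂.F
        rw [hs₂F]
        exact isPermissibleCentre_child_depthThree
      · rw [Finset.mem_singleton] at he he'
        exact absurd (he.trans he'.symm) hne'
      · have hj1 : j'' = 1 := Finset.mem_singleton.mp hj''
        subst hj1
        refine Or.inl ⟨e₀, Finset.mem_singleton_self _, rfl, fun i hi => ?_⟩
        change i ∈ ({1} : Finset (Fin 4)) at hi
        rw [Finset.mem_singleton] at hi
        subst hi
        exact hb''
    · -- at the child: dead
      rw [show plan (s₂, ({1} : Finset (Fin 4))).1 (s₂, ({1} : Finset (Fin 4))).2 = ∅ from hplan₂ {1}]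
      refine ⟨fun e he => absurd he (Finset.notMem_empty e), fun e he => absurd he (Finset.notMem_empty e),
        fun l hl => absurd hl (Finset.notMem_empty l), fun j'' b'' hj'' hb'' _ heq => ?_⟩
      exact absurd heq (not_isEquimultiplePoint_T_threefolds hj'' b'' _ hs₂F)
  · -- `Acc` below the waiting kid
    rw [Finset.mem_singleton] at hwt
    subst hwt
    exact hacc₁
  · -- the root cover: `b₁ = 0` (host) or `b₂ = 0` (waiting member)
    rcases roots_depthThree b' H with hb0 | hb1
    · left
      intro i hi
      rw [Finset.mem_singleton] at hi
      subst hi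
      rw [hb0]; rfl
    · right
      refine ⟨wt₀, Finset.mem_singleton_self _, fun i hi => ?_⟩
      change i ∈ ({1} : Finset (Fin 4)) at hi
      rw [Finset.mem_singleton] at hi
      subst hi
      rw [hb1]; simp [hwt₀]

end Instance₁₄

end Equimultiple

end Summit.ResolutionOfSingularities.ResolutionOfSingularities.Theorems.PIDim4

end
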